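import Summits.RiemannHypothesis.RiemannHypothesis.Theorems.WeilBochnerMeasureWindow
import HarnessLib

/-!
# RiemannHypothesis — Yoshida's Gram matrix entrywise: `G(n,m) = ∫ Re(χ̂_n · conj χ̂_m) dμ`

Helper file (`--supports stmt-RiemannHypothesis-0098`), RH-free, standard axioms.  Seat rh-explicit
weil-3 (structure).  Entrywise form of `sum_mul_mul_gramCoeff_eq_integral`
(`WeilBochnerMeasureWindow.lean`): for every measure `μ` representing Weil's form on the tests of
`[-a, a]` (`a > 0`) and all `n, m ∈ ℤ`,

  `gramCoeff a n m = ∫ Re( χ̂_n(½+it) · conj χ̂_m(½+it) ) dμ(t)`   (`gramCoeff_eq_integral`),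

i.e. Yoshida's matrix (5.15)/(5.16) IS the Gram matrix of the window's trigonometric system
`{χ̂_n(½+i·)}` (shifted sinc kernels) in `L²(μ)`.  Proof: the transform of a trigonometric window is the
corresponding combination of the `χ̂_n` (`weilMellin_sum_smul_chi`), `‖Σ x_n χ̂_n‖² = Σ x_n x_m Re(χ̂_n χ̂̄_m)`,
so the two real symmetric matrices define the same quadratic form on every finite set of modes;
polarise (`gramCoeff_comm`).
-/

noncomputable section

set_option linter.dupNamespace false  -- the mandated namespace repeats `RiemannHypothesis`

open Complex Filter Set MeasureTheory
open scoped Real Topology ComplexConjugate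
open Literature.NumberTheory.LFunctions
open Literature.NumberTheory.LFunctions.Yoshida1992 (chi chiCore gramCoeff gramCoeff_comm)
open Summit.RiemannHypothesis.RiemannHypothesis.Theorems.WeilFormatC

namespace Summit.RiemannHypothesis.RiemannHypothesis.Theorems.WeilBochnerMeasure

variable {a : ℝ}

/-! ## Transforms of trigonometric windows -/

/-- The critical-line integrand `x ↦ χ_n(x) e^{itx}` of `χ̂_n(½+it)` is integrable (bounded by
`(2a)^{-1/2}` on `[-a, a]`, zero outside). -/
theorem integrable_chi_mul_cexp (a : ℝ) (n : ℤ) (t : ℝ) :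
    Integrable fun x : ℝ ↦ chi a n x * cexp ((1 / 2 + (t : ℂ) * I - 1 / 2) * (x : ℂ)) := by
  have hmeas : AEStronglyMeasurable
      (fun x : ℝ ↦ chi a n x * cexp ((1 / 2 + (t : ℂ) * I - 1 / 2) * (x : ℂ))) volume :=
    ((measurable_chi a n).mul (by fun_prop : Continuous fun x : ℝ ↦
      cexp ((1 / 2 + (t : ℂ) * I - 1 / 2) * (x : ℂ))).measurable).aestronglyMeasurable
  have hind : Integrable fun x : ℝ ↦ (Icc (-a) a).indicator (fun _ ↦ 1 / Real.sqrt (2 * a)) x :=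
    (integrable_indicator_iff measurableSet_Icc).2 (integrableOn_const (by simp [Real.volume_Icc]))
  refine hind.mono' hmeas (ae_of_all _ fun x ↦ ?_)
  have hexp : ‖cexp ((1 / 2 + (t : ℂ) * I - 1 / 2) * (x : ℂ))‖ = 1 := by
    rw [show (1 / 2 + (t : ℂ) * I - 1 / 2) * (x : ℂ) = ((t * x : ℝ) : ℂ) * I by push_cast; ring,
      Complex.norm_exp_ofReal_mul_I]
  rw [norm_mul, hexp, mul_one]
  by_cases hx : x ∈ Icc (-a) a
  · rw [indicator_of_mem hx]; exact norm_chi_le a n x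
  · rw [indicator_of_notMem hx, chi_apply_of_not_mem n hx, norm_zero]

/-- **Transform of a trigonometric window**: `(Σ_{n∈s} c_n χ_n)^(½+it) = Σ_{n∈s} c_n χ̂_n(½+it)`. -/
theorem weilMellin_sum_smul_chi (a : ℝ) (s : Finset ℤ) (c : ℤ → ℂ) (t : ℝ) :
    weilMellin (∑ n ∈ s, c n • chi a n) (1 / 2 + t * I) =
      ∑ n ∈ s, c n * weilMellin (chi a n) (1 / 2 + t * I) := by
  unfold weilMellin
  have e : (fun x : ℝ ↦ (∑ n ∈ s, c n • chi a n) x * cexp ((1 / 2 + (t : ℂ) * I - 1 / 2) * (x : ℂ))) =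
      fun x ↦ ∑ n ∈ s, c n * (chi a n x * cexp ((1 / 2 + (t : ℂ) * I - 1 / 2) * (x : ℂ))) := by
    funext x
    simp only [Finset.sum_apply, Pi.smul_apply, smul_eq_mul, Finset.sum_mul]
    refine Finset.sum_congr rfl fun n _ ↦ ?_
    ring
  rw [e, integral_finsetSum _ fun n _ ↦ (integrable_chi_mul_cexp a n t).const_mul (c n)]
  refine Finset.sum_congr rfl fun n _ ↦ ?_
  rw [integral_const_mul]

/-! ## The moment matrix and the entrywise identity -/

/-- `‖Σ_n x_n z_n‖² = Σ_n Σ_m x_n x_m Re(z_n conj z_m)` for real `x`. -/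
theorem norm_sum_real_mul_sq (s : Finset ℤ) (x : ℤ → ℝ) (z : ℤ → ℂ) :
    ‖∑ n ∈ s, (x n : ℂ) * z n‖ ^ 2 = ∑ n ∈ s, ∑ m ∈ s, x n * x m * (z n * conj (z m)).re := by
  set S : ℂ := ∑ n ∈ s, (x n : ℂ) * z n with hS
  have h1 : ‖S‖ ^ 2 = (S * conj S).re := by
    rw [Complex.mul_conj, Complex.ofReal_re, Complex.normSq_eq_norm_sq]
  rw [h1, hS, map_sum, Finset.sum_mul_sum, Complex.re_sum]
  refine Finset.sum_congr rfl fun n _ ↦ ?_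
  rw [Complex.re_sum]
  refine Finset.sum_congr rfl fun m _ ↦ ?_
  rw [map_mul, Complex.conj_ofReal,
    show (x n : ℂ) * z n * ((x m : ℂ) * conj (z m)) = ((x n * x m : ℝ) : ℂ) * (z n * conj (z m)) by
      push_cast; ring, Complex.re_ofReal_mul]

/-- **Yoshida's Gram matrix, entrywise, as moments of a representing measure.**  For `a > 0`, every
measure `μ` representing Weil's form on the tests supported in `[-a, a]`, and all `n, m ∈ ℤ`:
`‖χ̂_n‖ · ‖χ̂_m‖ ∈ L¹(μ)`-type integrability holds and

  `gramCoeff a n m = ∫ Re( χ̂_n(½+it) · conj χ̂_m(½+it) ) dμ(t)`. -/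
theorem gramCoeff_eq_integral (ha : 0 < a) {μ : Measure ℝ}
    (hμ : ∀ g : ℝ → ℂ, IsWeilTest g → tsupport g ⊆ Icc (-a) a →
      Integrable (fun t : ℝ ↦ ‖weilMellin g (1 / 2 + t * I)‖ ^ 2) μ ∧
        weilQuadratic g = ((∫ t, ‖weilMellin g (1 / 2 + t * I)‖ ^ 2 ∂μ : ℝ) : ℂ))
    (n m : ℤ) :
    Integrable (fun t : ℝ ↦ (weilMellin (chi a n) (1 / 2 + t * I) *
      conj (weilMellin (chi a m) (1 / 2 + t * I))).re) μ ∧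
    gramCoeff a n m = ∫ t, (weilMellin (chi a n) (1 / 2 + t * I) *
      conj (weilMellin (chi a m) (1 / 2 + t * I))).re ∂μ := by
  -- notation
  set Z : ℤ → ℝ → ℂ := fun k t ↦ weilMellin (chi a k) (1 / 2 + t * I) with hZ
  set P : ℤ → ℤ → ℝ → ℝ := fun k l t ↦ (Z k t * conj (Z l t)).re with hP
  -- `‖χ̂_k‖² ∈ L¹(μ)` for every mode (the trigonometric window with one mode)
  have hsq : ∀ k : ℤ, Integrable (fun t ↦ ‖Z k t‖ ^ 2) μ := by
    intro k
    have h := (weilWindowForm_sum_smul_chi_eq_integral ha hμ {k} (fun _ ↦ (1 : ℂ))).1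
    refine h.congr (ae_of_all _ fun t ↦ ?_)
    simp only [Finset.sum_singleton, one_smul, hZ]
  -- measurability of the transforms `χ̂_k(½+it)` in `t` (parametric integral of a jointly measurable,
  -- dominated integrand): obtained as continuity
  have hZc : ∀ k : ℤ, Continuous (Z k) := by
    intro k
    -- continuity of `t ↦ χ̂_k(½+it)`: dominated convergence for the parametric integral
    refine continuous_iff_continuousAt.2 fun t₀ ↦ ?_
    simp only [hZ]
    unfold weilMellin
    refine MeasureTheory.continuousAt_of_dominated (bound := fun x ↦ (Icc (-a) a).indicator
      (fun _ ↦ 1 / Real.sqrt (2 * a)) x) ?_ ?_ ?_ ?_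
    · exact Eventually.of_forall fun t ↦ (integrable_chi_mul_cexp a k t).aestronglyMeasurable
    · refine Eventually.of_forall fun t ↦ ae_of_all _ fun x ↦ ?_
      have hexp : ‖cexp ((1 / 2 + (t : ℂ) * I - 1 / 2) * (x : ℂ))‖ = 1 := by
        rw [show (1 / 2 + (t : ℂ) * I - 1 / 2) * (x : ℂ) = ((t * x : ℝ) : ℂ) * I by push_cast; ring,
          Complex.norm_exp_ofReal_mul_I]
      rw [norm_mul, hexp, mul_one]
      by_cases hx : x ∈ Icc (-a) a
      · rw [indicator_of_mem hx]; exact norm_chi_le a k x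
      · rw [indicator_of_notMem hx, chi_apply_of_not_mem k hx, norm_zero]
    · exact (integrable_indicator_iff measurableSet_Icc).2 (integrableOn_const (by simp [Real.volume_Icc]))
    · refine ae_of_all _ fun x ↦ ?_
      exact ((continuous_const.mul ((by fun_prop : Continuous fun t : ℝ ↦
        cexp ((1 / 2 + (t : ℂ) * I - 1 / 2) * (x : ℂ))))).continuousAt)
  have hPi : ∀ k l : ℤ, Integrable (P k l) μ := by
    intro k l
    refine Integrable.mono' (((hsq k).add (hsq l)).div_const 2)
      ((Complex.continuous_re.comp ((hZc k).mul (Complex.continuous_conj.comp (hZc l)))).aestronglyMeasurable)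
      (ae_of_all _ fun t ↦ ?_)
    simp only [hP, Real.norm_eq_abs, Pi.add_apply]
    have h1 : |(Z k t * conj (Z l t)).re| ≤ ‖Z k t * conj (Z l t)‖ := Complex.abs_re_le_norm _
    rw [norm_mul, Complex.norm_conj] at h1
    nlinarith [sq_nonneg (‖Z k t‖ - ‖Z l t‖), norm_nonneg (Z k t), norm_nonneg (Z l t)]
  have hPsymm : ∀ k l t, P k l t = P l k t := fun k l t ↦ by
    simp only [hP]
    rw [← Complex.conj_re (Z k t * conj (Z l t)), map_mul, Complex.conj_conj, mul_comm]
  -- the two quadratic forms agree on every finite set of modes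
  have hforms : ∀ (s : Finset ℤ) (x : ℤ → ℝ),
      ∑ k ∈ s, ∑ l ∈ s, x k * x l * gramCoeff a k l = ∑ k ∈ s, ∑ l ∈ s, x k * x l * ∫ t, P k l t ∂μ := by
    intro s x
    rw [sum_mul_mul_gramCoeff_eq_integral ha hμ s x]
    have e : (fun t : ℝ ↦ ‖weilMellin (∑ k ∈ s, (x k : ℂ) • chi a k) (1 / 2 + t * I)‖ ^ 2) =
        fun t ↦ ∑ k ∈ s, ∑ l ∈ s, x k * x l * P k l t := by
      funext t
      rw [weilMellin_sum_smul_chi]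
      exact norm_sum_real_mul_sq s x (fun k ↦ Z k t)
    rw [e, integral_finsetSum _ fun k _ ↦ integrable_finsetSum _ fun l _ ↦ (hPi k l).const_mul _]
    refine Finset.sum_congr rfl fun k _ ↦ ?_
    rw [integral_finsetSum _ fun l _ ↦ (hPi k l).const_mul _]
    refine Finset.sum_congr rfl fun l _ ↦ ?_
    exact integral_const_mul _ _
  refine ⟨hPi n m, ?_⟩
  show gramCoeff a n m = ∫ t, P n m t ∂μ
  -- polarisation on `s = {n, m}`
  have hdiag : ∀ k : ℤ, gramCoeff a k k = ∫ t, P k k t ∂μ := fun k ↦ by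
    have h := hforms {k} (fun _ ↦ 1)
    simp only [Finset.sum_singleton, one_mul] at h
    exact h
  by_cases hnm : n = m
  · subst hnm
    exact hdiag n
  · classical
    have hMsymm : ∫ t, P m n t ∂μ = ∫ t, P n m t ∂μ := integral_congr_ae (ae_of_all _ fun t ↦ hPsymm m n t)
    have h := hforms {n, m} (fun _ ↦ 1)
    simp only [Finset.sum_pair hnm, one_mul] at h
    rw [hdiag n, hdiag m, gramCoeff_comm a m n, hMsymm] at h
    linarith

end Summit.RiemannHypothesis.RiemannHypothesis.Theorems.WeilBochnerMeasure

end
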